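import Summits.CriticalPhenomena.PercolationContinuityZ3.Theorems.PercNearOneGluingNoHeavyRsw3InnerClusterExit
import HarnessLib

/-!
# RSW3 lane (P2, gen 19): INNER-CLUSTER EVENTS AND THE FAR ARM — under (A2)□ the far arm factorises through the cluster of the
# origin inside `Λ(m−1)`: `ϰ · π_p(N) · P_p(F ∩ {0 ↔ ∂ⁱⁿΛ(sm)}) ≤ π_p(sm) · P_p(F ∩ {0 ↔ ∂ⁱⁿΛ(N)})` for every event `F` that depends
# only on that cluster (every `p`; a transfer principle towards Kesten's IIC)

builds on p205010 (kernel theorem, internal audit signed; external expert review pending) — NOT used in this file.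

Cell `prim-rsw3`, prover seat `prim-rsw3-p2` (gen 19), memo `run/shared/lean/prim/rsw3/P2-RSWLITE.md` §26 (V73, Step 1).
Support file (`--supports stmt-CriticalPhenomena-4575`); no definitions, no named facts, no sorries.

Let `S = Λ(m−1)`, `𝒞(ω)` = the cluster of `0` inside `S` (the Literature library's `DCT16.clusterSet S ω`), and let `F` be an event
depending on `ω` only through `𝒞(ω)`.  Duminil-Copin–Tassion's exploration decomposition (`DCT16.exists_decomposition`: last visit `x`
of an arm to `𝒞 = C`, an open edge `xy` with `y ∉ S`, then `y ↔ target` inside `Λ(N) ∖ C`; the three pieces live on disjoint sets of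
pairs) is combined with Basu–Sapozhnikov's (A2)□ IN THE DOMAIN `Z = Λ(N) ∖ C` (allowed: `C ⊆ Λ(m−1)`) applied to the random set of
activated exit sites:

(exit events, exploration step, independence: part I `…Rsw3InnerClusterExit.lean`)
* `real_exitUnion_ge_of_setToSetQuasiMultAspectAt` — (A2)□ for the exit events: `P(Exit_C(∂ⁱⁿΛ(N))) ≥ ϰ·P[∂ⁱⁿΛ(N) ↔ ∂ⁱⁿΛ(sm) in Λ(N)∖C]·
  P(Exit_C(∂ⁱⁿΛ(sm)))` (partition over the activated set `A₀`, (A2)□ with `X = A₀`);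
* **`mul_oneArmProb_mul_real_inter_le_of_innerCluster`** — THE TRANSFER INEQUALITY: for `F` with `(𝒞(ω) = 𝒞(ω') → (ω ∈ F ↔ ω' ∈ F))`,
  `1 ≤ m`, `L·m < N`:  `ϰ · π_p(N) · P_p(F ∩ {0 ↔ ∂ⁱⁿΛ(sm)}) ≤ π_p(sm) · P_p(F ∩ {0 ↔ ∂ⁱⁿΛ(N)})`.
READING: `P_p(F | 0 ↔ ∂ⁱⁿΛ(N)) ≥ ϰ·(π(N)/(π(sm)·u))⁻¹… ≥ ϰ · P_p(F ∩ A_{sm})/π(sm)`-type: conditioning on a LONGER arm lowers the probability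
of an inner-cluster event by at most the factor `ϰ`, uniformly in `N` — hence for Kesten's IIC measure `ν` (when it exists),
`ν(F) ≥ ϰ · P_p(F ∩ A_{sm})/π_p(sm)` (file `…Rsw3InnerClusterTransferIIC`).  This is Step 1 of memo §26 V73; the missing Step 2 is a
lower bound on `P(F ∩ A_{sm})` for `F` = inner fatness.

References: H. Duminil-Copin, V. Tassion, Enseign. Math. 62 (2016), §2.1 (the exploration decomposition) [DuminilCopinTassionEM2016];
D. Basu, A. Sapozhnikov, ECP 22 (2017), §1 (A2) and §2 [BasuSapozhnikov2017ECP]; H. Kesten, PTRF 73 (1986) (IIC) [Kesten1986];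
G. Grimmett, *Percolation* (1999), §2.2 [GrimmettPercolation1999]. [folklore]
-/

noncomputable section

namespace Summit.CriticalPhenomena.PercolationContinuityZ3.Theorems

namespace Rsw3

open MeasureTheory Literature.Probability.LatticeModels Literature.Probability.Percolation
open SurfaceTension Crossing SimpleGraph

variable {d : ℕ}

/-! ## (A2)□ for the exit events: partition over the set of activated exit sites -/

open Classical in
/-- **(A2)□ transfers to the exit events** (every `p`; `SetToSetQuasiMultAspectAt d p s L ϰ`, `1 ≤ m`, `C ⊆ Λ(m−1)`, `L·m < N`):
with `Z = Λ(N) ∖ C`, `S' = ∂ⁱⁿΛ(sm)`, `Y = ∂ⁱⁿΛ(N)`,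
(`L ≥ 1`) `ϰ · P[Y ↔ S' in Z] · P(Exit_C(S')) ≤ P(Exit_C(Y))` — partition over the set `A₀` of activated exit sites (determined by the edges
from `C` to the shell, disjoint from the pairs of `Z`), and (A2)□ in the domain `Z` with inner set `A₀ ⊆ Λ(m)`.
[cite: BasuSapozhnikov2017ECP, §1 assumption (A2)] [cite: DuminilCopinTassionEM2016, §2.1] -/
theorem real_exitUnion_ge_of_setToSetQuasiMultAspectAt (p : unitInterval) {s L : ℕ} {ϰ : ℝ}
    (hA2 : SetToSetQuasiMultAspectAt d p s L ϰ) (hL : 1 ≤ L) {m N : ℕ} (hm : 1 ≤ m) (hN : L * m < N)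
    {C : Finset (Site d)} (hC : C ⊆ box d (m - 1)) :
    ϰ * (bondPercolation (zdGraph d) p).real
        {ω | ∃ y ∈ innerBoundary (zdGraph d) (box d N), ∃ t ∈ innerBoundary (zdGraph d) (box d (s * m)),
          ω ∈ openConnIn ((↑(box d N \ C) : Set (Site d))) y t} *
      (bondPercolation (zdGraph d) p).real
        {ω | ∃ x ∈ C, ∃ y ∈ box d m \ box d (m - 1), (zdGraph d).Adj x y ∧ s(x, y) ∈ ω ∧
          ∃ t ∈ innerBoundary (zdGraph d) (box d (s * m)), ω ∈ openConnIn ((↑(box d N \ C) : Set (Site d))) y t} ≤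
      (bondPercolation (zdGraph d) p).real
        {ω | ∃ x ∈ C, ∃ y ∈ box d m \ box d (m - 1), (zdGraph d).Adj x y ∧ s(x, y) ∈ ω ∧
          ∃ t ∈ innerBoundary (zdGraph d) (box d N), ω ∈ openConnIn ((↑(box d N \ C) : Set (Site d))) y t} := by
  classical
  set μ := bondPercolation (zdGraph d) p with hμ
  set Sh : Finset (Site d) := box d m \ box d (m - 1) with hSh
  set Z : Finset (Site d) := box d N \ C with hZ
  set S' : Finset (Site d) := innerBoundary (zdGraph d) (box d (s * m)) with hS'
  set Y : Finset (Site d) := innerBoundary (zdGraph d) (box d N) with hY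
  -- the activated set and its level events
  set act : BondConfig (Site d) → Finset (Site d) := fun ω =>
    Sh.filter (fun y => ∃ x ∈ C, (zdGraph d).Adj x y ∧ s(x, y) ∈ ω) with hact
  set Ev : Finset (Site d) → Set (BondConfig (Site d)) := fun A₀ => {ω | act ω = A₀} with hEv
  set Cr : Finset (Site d) → Finset (Site d) → Set (BondConfig (Site d)) := fun A₀ T =>
    {ω | ∃ y ∈ A₀, ∃ t ∈ T, ω ∈ openConnIn (↑Z : Set (Site d)) y t} with hCr
  set Ex : Finset (Site d) → Set (BondConfig (Site d)) := fun T =>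
    {ω | ∃ x ∈ C, ∃ y ∈ Sh, (zdGraph d).Adj x y ∧ s(x, y) ∈ ω ∧ ∃ t ∈ T, ω ∈ openConnIn (↑Z : Set (Site d)) y t} with hEx
  -- (1) `Exit(T) = ⋃_{A₀} Ev A₀ ∩ Cr A₀ T`
  have hdecomp : ∀ T : Finset (Site d), Ex T = ⋃ A₀ ∈ Sh.powerset, (Ev A₀ ∩ Cr A₀ T) := by
    intro T
    ext ω
    simp only [hEx, hEv, hCr, Set.mem_setOf_eq, Set.mem_iUnion, Set.mem_inter_iff, Finset.mem_powerset, exists_prop]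
    constructor
    · rintro ⟨x, hx, y, hy, hxy, ho, t, ht, hyt⟩
      refine ⟨act ω, Finset.filter_subset _ _, rfl, y, ?_, t, ht, hyt⟩
      exact Finset.mem_filter.2 ⟨hy, x, hx, hxy, ho⟩
    · rintro ⟨A₀, -, hA₀, y, hy, t, ht, hyt⟩
      rw [← hA₀] at hy
      obtain ⟨hySh, x, hx, hxy, ho⟩ := Finset.mem_filter.1 hy
      exact ⟨x, hx, y, hySh, hxy, ho, t, ht, hyt⟩
  -- (2) supports: `Ev A₀` on the activation edges, `Cr A₀ T` on the pairs of `Z`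
  set Eact : Finset (Sym2 (Site d)) := (C ×ˢ Sh).image fun q => s(q.1, q.2) with hEact
  have hEv_det : ∀ A₀, DeterminedBy (Ev A₀) (↑Eact : Set (Sym2 (Site d))) := by
    intro A₀
    rw [determinedBy_iff]
    intro ω ω' h
    have hact_eq : act ω = act ω' := by
      simp only [hact]
      refine Finset.filter_congr fun y hy => ?_
      refine exists_congr fun x => and_congr_right fun hx => and_congr_right fun _ => ?_
      have he : s(x, y) ∈ (↑Eact : Set (Sym2 (Site d))) :=
        Finset.mem_coe.2 (Finset.mem_image.2 ⟨(x, y), Finset.mem_product.2 ⟨hx, hy⟩, rfl⟩)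
      constructor
      · intro hω; have : s(x, y) ∈ ω ∩ ↑Eact := ⟨hω, he⟩; rw [h] at this; exact this.1
      · intro hω'; have : s(x, y) ∈ ω' ∩ ↑Eact := ⟨hω', he⟩; rw [← h] at this; exact this.1
    simp only [hEv, Set.mem_setOf_eq, hact_eq]
  have hCr_det : ∀ A₀ T, DeterminedBy (Cr A₀ T) (↑Z.sym2 : Set (Sym2 (Site d))) := by
    intro A₀ T
    have h : Cr A₀ T = ⋃ y ∈ A₀, ⋃ t ∈ T, openConnIn (↑Z : Set (Site d)) y t := by
      ext ω; simp only [hCr, Set.mem_setOf_eq, Set.mem_iUnion, exists_prop]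
    rw [h]
    exact DeterminedBy.iUnion fun y => DeterminedBy.iUnion fun _ => DeterminedBy.iUnion fun t =>
      DeterminedBy.iUnion fun _ => DCT16.determinedBy_openConnIn _ y t (K := ↑Z.sym2) (by rw [Finset.coe_sym2])
  have hdisj : Disjoint Eact Z.sym2 := by
    rw [Finset.disjoint_left]
    intro e he he'
    obtain ⟨q, hq, rfl⟩ := Finset.mem_image.1 he
    obtain ⟨hq1, -⟩ := Finset.mem_product.1 hq
    have := (Finset.mk_mem_sym2_iff.1 he').1
    rw [hZ, Finset.mem_sdiff] at this
    exact this.2 hq1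
  have hind : ∀ A₀ T, μ.real (Ev A₀ ∩ Cr A₀ T) = μ.real (Ev A₀) * μ.real (Cr A₀ T) := fun A₀ T =>
    DCT16.real_inter_of_determinedBy_disjoint (zdGraph d) p (hEv_det A₀) (hCr_det A₀ T) hdisj
  -- (3) `P(Exit(T)) = Σ_{A₀} P(Ev A₀) P(Cr A₀ T)`
  have hsum : ∀ T : Finset (Site d), μ.real (Ex T) = ∑ A₀ ∈ Sh.powerset, μ.real (Ev A₀) * μ.real (Cr A₀ T) := by
    intro T
    rw [hdecomp T, measureReal_biUnion_finset]
    · exact Finset.sum_congr rfl fun A₀ _ => hind A₀ T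
    · intro A₀ _ A₁ _ hne
      refine Set.disjoint_left.2 fun ω h h' => hne ?_
      have h1 : act ω = A₀ := h.1
      have h2 : act ω = A₁ := h'.1
      rw [← h1, h2]
    · intro A₀ _
      exact ((hEv_det A₀).measurableSet_of_finset).inter ((hCr_det A₀ T).measurableSet_of_finset)
  -- (4) (A2)□ in `Z` for each `A₀ ⊆ Sh`
  have hZsub : box d (L * m) \ box d (m - 1) ⊆ Z := by
    rw [hZ]
    exact Finset.sdiff_subset_sdiff (box_mono d hN.le) hC
  have hYsub : Y ⊆ Z \ box d (L * m) := by
    intro y hy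
    rw [hY] at hy
    have hyN := mem_innerBoundary_iff.1 hy
    rw [Finset.mem_sdiff, hZ, Finset.mem_sdiff]
    refine ⟨⟨hyN.1, fun hyC => ?_⟩, DCT16.notMem_box_of_mem_innerBoundary_box hN hy⟩
    have hmL : m - 1 ≤ L * m := (Nat.sub_le m 1).trans (Nat.le_mul_of_pos_left m hL)
    have := box_mono d hmL (hC hyC)
    exact DCT16.notMem_box_of_mem_innerBoundary_box hN hy this
  have hA2step : ∀ A₀ ∈ Sh.powerset, ϰ * (μ.real (Cr A₀ S') * μ.real (Cr Y S')) ≤ μ.real (Cr A₀ Y) := by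
    intro A₀ hA₀
    rw [Finset.mem_powerset] at hA₀
    have hX : A₀ ⊆ Z ∩ box d m := by
      intro y hy
      have hySh := hA₀ hy
      rw [hSh, Finset.mem_sdiff] at hySh
      rw [Finset.mem_inter, hZ, Finset.mem_sdiff]
      have hmN : m ≤ N := (Nat.le_mul_of_pos_left m hL).trans hN.le
      exact ⟨⟨box_mono d hmN hySh.1, fun hyC => hySh.2 (hC hyC)⟩, hySh.1⟩
    exact hA2 m hm Z hZsub A₀ hX Y hYsub
  -- (5) assemble
  rw [hsum S', hsum Y, Finset.mul_sum]
  refine Finset.sum_le_sum fun A₀ hA₀ => ?_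
  have h1 := hA2step A₀ hA₀
  have hEv0 : 0 ≤ μ.real (Ev A₀) := measureReal_nonneg
  calc ϰ * μ.real (Cr Y S') * (μ.real (Ev A₀) * μ.real (Cr A₀ S'))
      = μ.real (Ev A₀) * (ϰ * (μ.real (Cr A₀ S') * μ.real (Cr Y S'))) := by ring
    _ ≤ μ.real (Ev A₀) * μ.real (Cr A₀ Y) := mul_le_mul_of_nonneg_left h1 hEv0

/-! ## The transfer inequality -/

open Classical in
/-- **INNER-CLUSTER EVENTS AND THE FAR ARM** (every `p`; `SetToSetQuasiMultAspectAt d p s L ϰ`, `ϰ ≥ 0`, `1 ≤ s ≤ L`, `1 ≤ m`, `L·m < N`).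
Let `F` be any event depending on `ω` only through the cluster of `0` inside `Λ(m−1)` (`DCT16.clusterSet (Λ(m−1)) ω`).  Then
`ϰ · π_p(N) · P_p(F ∩ {0 ↔ ∂ⁱⁿΛ(sm)}) ≤ π_p(sm) · P_p(F ∩ {0 ↔ ∂ⁱⁿΛ(N)})`,
i.e. `P_p(F ∩ A_N)/π_p(N) ≥ ϰ · P_p(F ∩ A_{sm})/π_p(sm)`: conditioning on a longer arm costs an inner-cluster event at most the factor `ϰ`.
Proof: partition over the values `C` of the inner cluster (DCT's `clusterEvent`), the exploration step and its converse, independence of the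
pieces, (A2)□ for the exit events in the domain `Λ(N) ∖ C`, and `π(N) ≤ π(sm)·P(Λ(sm) ↔ ∂ⁱⁿΛ(N)) ≤ π(sm)·P[∂ⁱⁿΛ(N) ↔ ∂ⁱⁿΛ(sm) in Λ(N) ∖ Λ(sm−1)]`.
[cite: BasuSapozhnikov2017ECP, §1 assumption (A2) and §2] [cite: DuminilCopinTassionEM2016, §2.1] [cite: Kesten1986, §2] -/
theorem mul_oneArmProb_mul_real_inter_le_of_innerCluster (p : unitInterval) {s L : ℕ} {ϰ : ℝ}
    (hA2 : SetToSetQuasiMultAspectAt d p s L ϰ) (hϰ : 0 ≤ ϰ) (hs : 1 ≤ s) (hsL : s ≤ L) {m N : ℕ} (hm : 1 ≤ m) (hN : L * m < N)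
    {F : Set (BondConfig (Site d))}
    (hF : ∀ ω ω' : BondConfig (Site d), DCT16.clusterSet (box d (m - 1)) ω = DCT16.clusterSet (box d (m - 1)) ω' →
      (ω ∈ F ↔ ω' ∈ F)) :
    ϰ * oneArmProb d p N * (bondPercolation (zdGraph d) p).real (F ∩ siteToBoundary d (s * m)) ≤
      oneArmProb d p (s * m) * (bondPercolation (zdGraph d) p).real (F ∩ siteToBoundary d N) := by
  classical
  set μ := bondPercolation (zdGraph d) p with hμ
  set S : Finset (Site d) := box d (m - 1) with hS
  set Sh : Finset (Site d) := box d m \ box d (m - 1) with hSh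
  set S' : Finset (Site d) := innerBoundary (zdGraph d) (box d (s * m)) with hS'
  set Y : Finset (Site d) := innerBoundary (zdGraph d) (box d N) with hY
  set Ex : Finset (Site d) → Finset (Site d) → Set (BondConfig (Site d)) := fun C T =>
    {ω | ∃ x ∈ C, ∃ y ∈ box d m \ box d (m - 1), (zdGraph d).Adj x y ∧ s(x, y) ∈ ω ∧
      ∃ t ∈ T, ω ∈ openConnIn ((↑(box d N \ C) : Set (Site d))) y t} with hEx
  have hsm : m ≤ s * m := Nat.le_mul_of_pos_left m hs
  have hsmN : s * m < N := lt_of_le_of_lt (Nat.mul_le_mul_right m hsL) hN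
  have h0 : (0 : Site d) ∈ S := zero_mem_box d _
  -- the `F`-compatible clusters
  set 𝓕 : Finset (Finset (Site d)) := S.powerset.filter (fun C => ∃ ω ∈ F, DCT16.clusterSet S ω = ↑C) with h𝓕
  -- partition identity: `F ∩ A = ⋃_{C ∈ 𝓕} clusterEvent S C ∩ A`
  have hpart : ∀ A : Set (BondConfig (Site d)), F ∩ A = ⋃ C ∈ 𝓕, (DCT16.clusterEvent S C ∩ A) := by
    intro A
    ext ω
    simp only [Set.mem_inter_iff, Set.mem_iUnion, exists_prop, h𝓕, Finset.mem_filter, Finset.mem_powerset]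
    constructor
    · rintro ⟨hωF, hωA⟩
      refine ⟨S.filter (· ∈ DCT16.clusterSet S ω), ⟨Finset.filter_subset _ _, ω, hωF, ?_⟩, ?_, hωA⟩
      · exact (DCT16.coe_filter_clusterSet S ω).symm
      · exact (DCT16.coe_filter_clusterSet S ω).symm
    · rintro ⟨C, ⟨-, ω₀, hω₀F, hω₀⟩, hωC, hωA⟩
      refine ⟨(hF ω₀ ω ?_).1 hω₀F, hωA⟩
      rw [hω₀]; exact hωC.symm
  have hdisjC : ∀ (A : Set (BondConfig (Site d))),
      (↑𝓕 : Set (Finset (Site d))).PairwiseDisjoint fun C => DCT16.clusterEvent S C ∩ A := by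
    intro A C _ C' _ hCC'
    refine Set.disjoint_left.2 fun ω h h' => hCC' ?_
    exact Finset.coe_injective ((show DCT16.clusterSet S ω = ↑C from h.1).symm.trans h'.1)
  have hsumF : ∀ n : ℕ, μ.real (F ∩ siteToBoundary d n) = ∑ C ∈ 𝓕, μ.real (DCT16.clusterEvent S C ∩ siteToBoundary d n) := by
    intro n
    rw [hpart, measureReal_biUnion_finset (hdisjC _)]
    intro C _
    exact (DCT16.measurableSet_clusterEvent h0).inter (DCT16.measurableSet_siteToBoundary d n)
  -- the domain-uniform second factor `g₀`
  set g₀ : ℝ := μ.real {ω | ∃ y ∈ Y, ∃ t ∈ S', ω ∈ openConnIn ((↑(box d N \ box d (s * m - 1)) : Set (Site d))) y t} with hg₀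
  have hg₀C : ∀ C ∈ 𝓕, g₀ ≤ μ.real {ω | ∃ y ∈ Y, ∃ t ∈ S', ω ∈ openConnIn ((↑(box d N \ C) : Set (Site d))) y t} := by
    intro C hC
    have hCS : C ⊆ S := Finset.mem_powerset.1 (Finset.mem_filter.1 hC).1
    refine measureReal_mono (fun ω hω => ?_) (measure_ne_top _ _)
    obtain ⟨y, hy, t, ht, hyt⟩ := hω
    refine ⟨y, hy, t, ht, openConnIn_mono ?_ y t hyt⟩
    rw [Finset.coe_sdiff, Finset.coe_sdiff]
    exact Set.sdiff_subset_sdiff_right (Finset.coe_subset.2 (hCS.trans (box_mono d (Nat.sub_le_sub_right hsm 1))))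
  -- per-cluster inequality
  have hstep : ∀ C ∈ 𝓕, ϰ * g₀ * μ.real (DCT16.clusterEvent S C ∩ siteToBoundary d (s * m)) ≤
      μ.real (DCT16.clusterEvent S C ∩ siteToBoundary d N) := by
    intro C hC
    have hCS : C ⊆ S := Finset.mem_powerset.1 (Finset.mem_filter.1 hC).1
    have hcl0 : 0 ≤ μ.real (DCT16.clusterEvent S C) := measureReal_nonneg
    -- lower: `cl ∩ A_{sm} ⊆ cl ∩ Ex C S'` (a.s.)
    have h1 : μ.real (DCT16.clusterEvent S C ∩ siteToBoundary d (s * m)) ≤ μ.real (DCT16.clusterEvent S C ∩ Ex C S') := by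
      refine DCT16.real_mono_of_forall_subset_edgeSet (zdGraph d) p fun ω hω h => ?_
      exact ⟨h.1, mem_exitUnion_of_clusterEvent_of_siteToBoundary hm hsm hsmN.le hω h.1 h.2⟩
    -- upper: `cl ∩ Ex C Y ⊆ cl ∩ A_N`
    have h2 : μ.real (DCT16.clusterEvent S C ∩ Ex C Y) ≤ μ.real (DCT16.clusterEvent S C ∩ siteToBoundary d N) := by
      refine measureReal_mono (fun ω hω => ⟨hω.1, ?_⟩) (measure_ne_top _ _)
      have h := clusterEvent_inter_exitUnion_subset (le_of_lt (lt_of_le_of_lt (hsm.trans (Nat.mul_le_mul_right m hsL)) hN)) C Y hω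
      obtain ⟨x, hx, t, ht, hxt⟩ := h
      rw [Finset.mem_singleton] at hx
      subst hx
      exact (DCT16.mem_siteToBoundary_iff).2 ⟨t, ht, DCT16.pathIn_of_mem_openConnIn hxt⟩
    -- independence and (A2)□
    have h3 := real_exitUnion_ge_of_setToSetQuasiMultAspectAt p hA2 (hs.trans hsL) hm hN hCS
    have hind1 := real_clusterEvent_inter_exitUnion p m N C S'
    have hind2 := real_clusterEvent_inter_exitUnion p m N C Y
    calc ϰ * g₀ * μ.real (DCT16.clusterEvent S C ∩ siteToBoundary d (s * m))
        ≤ ϰ * g₀ * μ.real (DCT16.clusterEvent S C ∩ Ex C S') := mul_le_mul_of_nonneg_left h1 (mul_nonneg hϰ measureReal_nonneg)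
      _ = μ.real (DCT16.clusterEvent S C) * (ϰ * g₀ * μ.real (Ex C S')) := by rw [hind1]; ring
      _ ≤ μ.real (DCT16.clusterEvent S C) * (ϰ * μ.real {ω | ∃ y ∈ Y, ∃ t ∈ S',
            ω ∈ openConnIn ((↑(box d N \ C) : Set (Site d))) y t} * μ.real (Ex C S')) :=
          mul_le_mul_of_nonneg_left (mul_le_mul_of_nonneg_right (mul_le_mul_of_nonneg_left (hg₀C C hC) hϰ) measureReal_nonneg) hcl0
      _ ≤ μ.real (DCT16.clusterEvent S C) * μ.real (Ex C Y) := mul_le_mul_of_nonneg_left h3 hcl0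
      _ = μ.real (DCT16.clusterEvent S C ∩ Ex C Y) := hind2.symm
      _ ≤ μ.real (DCT16.clusterEvent S C ∩ siteToBoundary d N) := h2
  -- sum over `C`
  have hsum : ϰ * g₀ * μ.real (F ∩ siteToBoundary d (s * m)) ≤ μ.real (F ∩ siteToBoundary d N) := by
    rw [hsumF (s * m), hsumF N, Finset.mul_sum]
    exact Finset.sum_le_sum hstep
  -- `π(N) ≤ π(sm) · g₀`
  have hπ : oneArmProb d p N ≤ oneArmProb d p (s * m) * g₀ := by
    have hbk := oneArmProb_le_mul_boxCrossing_bk (d := d) p hsmN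
    have hle := real_boxCrossing_le_real_openCrossing_sdiff (d := d) p (by nlinarith : 1 ≤ s * m) hsmN.le
    have hflip : μ.real (openCrossing (↑(box d N \ box d (s * m - 1)) : Set (Site d))
        ↑(innerBoundary (zdGraph d) (box d (s * m))) ↑(innerBoundary (zdGraph d) (box d N))) ≤ g₀ := by
      refine measureReal_mono (fun ω hω => ?_) (measure_ne_top _ _)
      rw [mem_openCrossing_iff] at hω
      obtain ⟨t, ht, y, hy, hty⟩ := hω
      exact ⟨y, hy, t, ht, GM.openConnIn_comm.1 hty⟩
    calc oneArmProb d p N ≤ oneArmProb d p (s * m) * μ.real (boxCrossing d (s * m) N) := hbk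
      _ ≤ oneArmProb d p (s * m) * g₀ := mul_le_mul_of_nonneg_left (hle.trans hflip) measureReal_nonneg
  have hFsm0 : 0 ≤ μ.real (F ∩ siteToBoundary d (s * m)) := measureReal_nonneg
  calc ϰ * oneArmProb d p N * μ.real (F ∩ siteToBoundary d (s * m))
      ≤ ϰ * (oneArmProb d p (s * m) * g₀) * μ.real (F ∩ siteToBoundary d (s * m)) :=
        mul_le_mul_of_nonneg_right (mul_le_mul_of_nonneg_left hπ hϰ) hFsm0
    _ = oneArmProb d p (s * m) * (ϰ * g₀ * μ.real (F ∩ siteToBoundary d (s * m))) := by ring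
    _ ≤ oneArmProb d p (s * m) * μ.real (F ∩ siteToBoundary d N) := mul_le_mul_of_nonneg_left hsum measureReal_nonneg

end Rsw3

end Summit.CriticalPhenomena.PercolationContinuityZ3.Theorems
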